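import Mathlib
import Literature.Analysis.Matrix.EigenvalueCountOnSubspaces
import Summits.ValiantsHypothesis.ValiantsHypothesis.Theorems.LacunarySymmetroidMatrixDescartesInertiaKit
import Summits.ValiantsHypothesis.ValiantsHypothesis.Theorems.LacunarySymmetroidMatrixDescartesDetMultiplicityCorank

/-!
# `MatrixDescartes` (stmt-ValiantsHypothesis-18050) — INERTIA KIT, II: THE INERTIA LAW FOR ROOT COUNTS — across a window the
# negative index of a continuous symmetric family changes by at most the total corank at its singular points; for a
# lacunary symmetric pencil the roots of `det F` in `[a, b)` COUNTED WITH MULTIPLICITY number at least `ν(F(b)) − ν(F(a))`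

HONEST FRAMING.  Cell `pub-symmetroid`, seat `val-sym-mdr-p2` (gen 16); helper file `--supports` the crux
`Theses.LacunarySymmetroid.MatrixDescartes`, NO closure claim.  A general tool valid for EVERY real symmetric lacunary pencil at
EVERY format (a lower bound / bookkeeping identity for root counts with multiplicity, the accounting half of the exact zone
count `…DefiniteMomentsZonesExact`); nothing here bears on the crux in its window, on `stub_twoSided`, on `DoorA26`/`DoorA34`,
registers, or `VP ≠ VNP`.

THEOREM (`negIndex_le_add_sum_corank`).  `F : ℝ → Sym_ι(ℝ)` entrywise continuous, `a ≤ b`, `T` a finite set containing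
every singular point of `F` in `[a, b]`.  Then `ν(F(b)) ≤ ν(F(a)) + ∑_{t ∈ T, a ≤ t < b} corank F(t)`, and the same for the
positive index (`posIndex_le_add_sum_corank`).  PROOF: between consecutive singular points the index is locally constant
(`Inertia.eventually_negIndex_eq`) hence constant (`DefiniteMoments.constant_of_nhds`); across a singular point `t` it is
lower semicontinuous and rises by at most `corank F(t)` (`Inertia.eventually_negIndex_ge/_le`); induction on the number of
singular points in the open window.  PENCIL FORM (`pencil_negIndex_le_add_card_roots`): for `F(X) = ∑ₖ X^{dₖ}Sₖ` with real
symmetric letters and `det F ≢ 0`, `corank F(t) ≤ mult_t det F` (gen 15, `Multiplicity.le_rootMultiplicity_det_pencil_of_rank`)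
turns the sum into the number of roots of `det F` in `[a, b)` counted with multiplicity:
`ν(F(b)) ≤ ν(F(a)) + #{roots of det F in [a,b), with multiplicity}` — «the inertia cannot move faster than the determinant
vanishes». [folklore] (the classical eigenvalue-counting / IVT argument, Horn–Johnson Ch. 4 style); axioms standard;
no definitions.
-/

-- layout Summits/ValiantsHypothesis/ValiantsHypothesis forces the duplicated namespace component
set_option linter.dupNamespace false

namespace Summit.ValiantsHypothesis.ValiantsHypothesis.Theorems.LacunarySymmetroidMatrixDescartes

open Polynomial Matrix Finset
open scoped BigOperators Topology

namespace Inertia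

variable {ι : Type} [Fintype ι] [DecidableEq ι]

/-! ## §1 A window without interior singular points -/

omit [Fintype ι] [DecidableEq ι] in
/-- A point of `(a, b)` within `ε` of `b`. [folklore] -/
theorem exists_mem_Ioo_near_right {a b ε : ℝ} (hab : a < b) (hε : 0 < ε) :
    ∃ x ∈ Set.Ioo a b, dist x b < ε := by
  refine ⟨b - min (ε / 2) ((b - a) / 2), ⟨?_, ?_⟩, ?_⟩
  · have : min (ε / 2) ((b - a) / 2) ≤ (b - a) / 2 := min_le_right _ _
    linarith
  · have : 0 < min (ε / 2) ((b - a) / 2) := lt_min (by linarith) (by linarith)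
    linarith
  · rw [Real.dist_eq, abs_lt]
    have h1 : 0 < min (ε / 2) ((b - a) / 2) := lt_min (by linarith) (by linarith)
    have h2 : min (ε / 2) ((b - a) / 2) ≤ ε / 2 := min_le_left _ _
    constructor <;> linarith

omit [Fintype ι] [DecidableEq ι] in
/-- A point of `(a, b)` within `ε` of `a`. [folklore] -/
theorem exists_mem_Ioo_near_left {a b ε : ℝ} (hab : a < b) (hε : 0 < ε) :
    ∃ x ∈ Set.Ioo a b, dist x a < ε := by
  refine ⟨a + min (ε / 2) ((b - a) / 2), ⟨?_, ?_⟩, ?_⟩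
  · have : 0 < min (ε / 2) ((b - a) / 2) := lt_min (by linarith) (by linarith)
    linarith
  · have : min (ε / 2) ((b - a) / 2) ≤ (b - a) / 2 := min_le_right _ _
    linarith
  · rw [Real.dist_eq, abs_lt]
    have h1 : 0 < min (ε / 2) ((b - a) / 2) := lt_min (by linarith) (by linarith)
    have h2 : min (ε / 2) ((b - a) / 2) ≤ ε / 2 := min_le_left _ _
    constructor <;> linarith

/-- **No interior singular point**: if `F` is non-singular on `(a, b)` then `ν(F(b)) ≤ ν(F(a)) + corank F(a)`.
[folklore] -/
theorem negIndex_le_of_noRoot (F : ℝ → Matrix ι ι ℝ) (hF : ∀ i j, Continuous fun x => F x i j)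
    (hH : ∀ x, (F x).IsHermitian) {a b : ℝ} (hab : a ≤ b) (hno : ∀ x ∈ Set.Ioo a b, (F x).det ≠ 0) :
    Fintype.card {j // (hH b).eigenvalues j < 0}
      ≤ Fintype.card {j // (hH a).eigenvalues j < 0} + (Fintype.card ι - (F a).rank) := by
  rcases eq_or_lt_of_le hab with rfl | hlt
  · exact Nat.le_add_right _ _
  -- the index is constant on `(a, b)`
  have hconst : ∀ x ∈ Set.Ioo a b, ∀ y ∈ Set.Ioo a b,
      Fintype.card {j // (hH x).eigenvalues j < 0} = Fintype.card {j // (hH y).eigenvalues j < 0} :=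
    fun x hx y hy => DefiniteMoments.constant_of_nhds (I := fun t => Fintype.card {j // (hH t).eigenvalues j < 0})
      isPreconnected_Ioo (fun t ht => eventually_negIndex_eq F hF hH t (hno t ht)) hx hy
  -- near `b`
  obtain ⟨ε, hε, hεb⟩ := Metric.eventually_nhds_iff.1 (eventually_negIndex_ge F hF hH b)
  obtain ⟨x₁, hx₁, hx₁b⟩ := exists_mem_Ioo_near_right hlt hε
  -- near `a`
  obtain ⟨ε', hε', hεa⟩ := Metric.eventually_nhds_iff.1 (eventually_negIndex_le F hF hH a)
  obtain ⟨x₂, hx₂, hx₂a⟩ := exists_mem_Ioo_near_left hlt hε'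
  calc Fintype.card {j // (hH b).eigenvalues j < 0}
      ≤ Fintype.card {j // (hH x₁).eigenvalues j < 0} := hεb hx₁b
    _ = Fintype.card {j // (hH x₂).eigenvalues j < 0} := hconst x₁ hx₁ x₂ hx₂
    _ ≤ Fintype.card {j // (hH a).eigenvalues j < 0} + (Fintype.card ι - (F a).rank) := hεa hx₂a

/-! ## §2 The window inequality -/

omit [Fintype ι] [DecidableEq ι] in
/-- Splitting the half-open window sum at an interior point. [folklore] -/
theorem sum_filter_Ico_split (T : Finset ℝ) (f : ℝ → ℕ) {a t₀ b : ℝ} (hat : a ≤ t₀) (htb : t₀ ≤ b) :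
    ∑ t ∈ T.filter (fun t => a ≤ t ∧ t < b), f t
      = ∑ t ∈ T.filter (fun t => a ≤ t ∧ t < t₀), f t + ∑ t ∈ T.filter (fun t => t₀ ≤ t ∧ t < b), f t := by
  rw [← Finset.sum_filter_add_sum_filter_not (T.filter fun t => a ≤ t ∧ t < b) (fun t => t < t₀) f,
    Finset.filter_filter, Finset.filter_filter]
  congr 1
  · refine Finset.sum_congr (Finset.filter_congr fun t _ => ?_) fun _ _ => rfl
    constructor
    · rintro ⟨⟨h1, -⟩, h3⟩; exact ⟨h1, h3⟩
    · rintro ⟨h1, h3⟩; exact ⟨⟨h1, lt_of_lt_of_le h3 htb⟩, h3⟩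
  · refine Finset.sum_congr (Finset.filter_congr fun t _ => ?_) fun _ _ => rfl
    constructor
    · rintro ⟨⟨-, h2⟩, h3⟩; exact ⟨not_lt.1 h3, h2⟩
    · rintro ⟨h1, h2⟩; exact ⟨⟨le_trans hat h1, h2⟩, not_lt.2 h1⟩

/-- Base case of the window inequality: no interior singular point. [folklore] -/
theorem negIndex_window_base (F : ℝ → Matrix ι ι ℝ) (hF : ∀ i j, Continuous fun x => F x i j)
    (hH : ∀ x, (F x).IsHermitian) (T : Finset ℝ) {a b : ℝ} (hab : a ≤ b)
    (hno : ∀ x ∈ Set.Ioo a b, (F x).det ≠ 0) (hT : ∀ x ∈ Set.Icc a b, (F x).det = 0 → x ∈ T) :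
    Fintype.card {j // (hH b).eigenvalues j < 0}
      ≤ Fintype.card {j // (hH a).eigenvalues j < 0} + ∑ t ∈ T.filter (fun t => a ≤ t ∧ t < b),
          (Fintype.card ι - (F t).rank) := by
  rcases eq_or_lt_of_le hab with rfl | hlt
  · exact Nat.le_add_right _ _
  refine le_trans (negIndex_le_of_noRoot F hF hH hab hno) (Nat.add_le_add_left ?_ _)
  by_cases hdet : (F a).det = 0
  · have haT : a ∈ T.filter (fun t => a ≤ t ∧ t < b) :=
      Finset.mem_filter.2 ⟨hT a ⟨le_rfl, hab⟩ hdet, le_rfl, hlt⟩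
    exact Finset.single_le_sum (f := fun t => Fintype.card ι - (F t).rank) (fun t _ => Nat.zero_le _) haT
  · rw [corank_eq_zero_of_det_ne_zero hdet]
    exact Nat.zero_le _

/-- Induction engine for the window inequality (on the number of interior singular points). [folklore] -/
theorem negIndex_window_aux (F : ℝ → Matrix ι ι ℝ) (hF : ∀ i j, Continuous fun x => F x i j)
    (hH : ∀ x, (F x).IsHermitian) (T : Finset ℝ) :
    ∀ (n : ℕ) (a b : ℝ), a ≤ b → (T.filter (fun t => a < t ∧ t < b)).card ≤ n →
      (∀ x ∈ Set.Icc a b, (F x).det = 0 → x ∈ T) →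
      Fintype.card {j // (hH b).eigenvalues j < 0}
        ≤ Fintype.card {j // (hH a).eigenvalues j < 0} + ∑ t ∈ T.filter (fun t => a ≤ t ∧ t < b),
            (Fintype.card ι - (F t).rank) := by
  intro n
  induction n with
  | zero =>
    intro a b hab hcard hT
    refine negIndex_window_base F hF hH T hab (fun x hx hdet => ?_) hT
    have hx' : x ∈ T.filter (fun t => a < t ∧ t < b) :=
      Finset.mem_filter.2 ⟨hT x ⟨hx.1.le, hx.2.le⟩ hdet, hx.1, hx.2⟩
    rw [Finset.card_eq_zero.1 (Nat.le_zero.1 hcard)] at hx'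
    simp at hx'
  | succ n ih =>
    intro a b hab hcard hT
    by_cases hne : (T.filter (fun t => a < t ∧ t < b)).Nonempty
    · obtain ⟨t₀, ht₀⟩ := hne
      obtain ⟨ht₀T, hat₀, ht₀b⟩ := Finset.mem_filter.1 ht₀
      have hsub1 : T.filter (fun t => a < t ∧ t < t₀) ⊆ (T.filter (fun t => a < t ∧ t < b)).erase t₀ := by
        intro t ht
        obtain ⟨htT, h1, h2⟩ := Finset.mem_filter.1 ht
        exact Finset.mem_erase.2 ⟨ne_of_lt h2, Finset.mem_filter.2 ⟨htT, h1, lt_trans h2 ht₀b⟩⟩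
      have hsub2 : T.filter (fun t => t₀ < t ∧ t < b) ⊆ (T.filter (fun t => a < t ∧ t < b)).erase t₀ := by
        intro t ht
        obtain ⟨htT, h1, h2⟩ := Finset.mem_filter.1 ht
        exact Finset.mem_erase.2 ⟨(ne_of_lt h1).symm, Finset.mem_filter.2 ⟨htT, lt_trans hat₀ h1, h2⟩⟩
      have hce := Finset.card_erase_of_mem ht₀
      have hc1 : (T.filter (fun t => a < t ∧ t < t₀)).card ≤ n := by
        have := Finset.card_le_card hsub1; omega
      have hc2 : (T.filter (fun t => t₀ < t ∧ t < b)).card ≤ n := by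
        have := Finset.card_le_card hsub2; omega
      have h1 := ih a t₀ hat₀.le hc1 (fun x hx hdx => hT x ⟨hx.1, le_trans hx.2 ht₀b.le⟩ hdx)
      have h2 := ih t₀ b ht₀b.le hc2 (fun x hx hdx => hT x ⟨le_trans hat₀.le hx.1, hx.2⟩ hdx)
      rw [sum_filter_Ico_split T _ hat₀.le ht₀b.le]
      omega
    · rw [Finset.not_nonempty_iff_eq_empty] at hne
      refine negIndex_window_base F hF hH T hab (fun x hx hdet => ?_) hT
      have hx' : x ∈ T.filter (fun t => a < t ∧ t < b) :=
        Finset.mem_filter.2 ⟨hT x ⟨hx.1.le, hx.2.le⟩ hdet, hx.1, hx.2⟩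
      rw [hne] at hx'
      simp at hx'

/-- **THE WINDOW INEQUALITY (negative index).**  `F` entrywise continuous and hermitian, `a ≤ b`, `T` a finite set containing
every singular point of `F` in `[a, b]`: `ν(F(b)) ≤ ν(F(a)) + ∑_{t ∈ T, a ≤ t < b} corank F(t)`. [folklore] -/
theorem negIndex_le_add_sum_corank (F : ℝ → Matrix ι ι ℝ) (hF : ∀ i j, Continuous fun x => F x i j)
    (hH : ∀ x, (F x).IsHermitian) (T : Finset ℝ) {a b : ℝ} (hab : a ≤ b)
    (hT : ∀ x ∈ Set.Icc a b, (F x).det = 0 → x ∈ T) :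
    Fintype.card {j // (hH b).eigenvalues j < 0}
      ≤ Fintype.card {j // (hH a).eigenvalues j < 0} + ∑ t ∈ T.filter (fun t => a ≤ t ∧ t < b),
          (Fintype.card ι - (F t).rank) :=
  negIndex_window_aux F hF hH T _ a b hab le_rfl hT

omit [DecidableEq ι] in
/-- Negation preserves the rank. [folklore] -/
theorem rank_neg_eq (A : Matrix ι ι ℝ) : (-A).rank = A.rank := by
  have h : (-A).mulVecLin = -A.mulVecLin := by
    apply LinearMap.ext
    intro v
    simp
  unfold Matrix.rank
  rw [h, LinearMap.range_neg]

/-- The positive index of `F` is the negative index of `−F`. [folklore] -/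
theorem posIndex_eq_negIndex_neg {A : Matrix ι ι ℝ} (hA : A.IsHermitian) (hA' : (-A).IsHermitian) :
    Fintype.card {j // 0 < hA.eigenvalues j} = Fintype.card {j // hA'.eigenvalues j < 0} := by
  classical
  rw [Fintype.card_subtype, Fintype.card_subtype,
    Literature.Analysis.Matrix.EigenvalueCountOnSubspaces.card_filter_eigenvalues_neg hA hA' (fun x => x < 0)]
  congr 1
  ext j
  simp

/-- **THE WINDOW INEQUALITY (positive index).** [folklore] -/
theorem posIndex_le_add_sum_corank (F : ℝ → Matrix ι ι ℝ) (hF : ∀ i j, Continuous fun x => F x i j)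
    (hH : ∀ x, (F x).IsHermitian) (T : Finset ℝ) {a b : ℝ} (hab : a ≤ b)
    (hT : ∀ x ∈ Set.Icc a b, (F x).det = 0 → x ∈ T) :
    Fintype.card {j // 0 < (hH b).eigenvalues j}
      ≤ Fintype.card {j // 0 < (hH a).eigenvalues j} + ∑ t ∈ T.filter (fun t => a ≤ t ∧ t < b),
          (Fintype.card ι - (F t).rank) := by
  have hH' : ∀ x, (-F x).IsHermitian := fun x => (hH x).neg
  have h := negIndex_le_add_sum_corank (fun x => -F x) (fun i j => (hF i j).neg) hH' T hab (fun x hx hdet => by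
    refine hT x hx ?_
    rw [Matrix.det_neg] at hdet
    simpa using hdet)
  rw [posIndex_eq_negIndex_neg (hH b) (hH' b), posIndex_eq_negIndex_neg (hH a) (hH' a)]
  refine le_trans h (Nat.add_le_add_left (le_of_eq (Finset.sum_congr rfl fun t _ => ?_)) _)
  rw [rank_neg_eq]

/-- **Two-sided form at non-singular endpoints**: `|ν(F(b)) − ν(F(a))| ≤ ∑_{t ∈ T, a < t < b} corank F(t)`. [folklore] -/
theorem negIndex_dist_le_sum_corank (F : ℝ → Matrix ι ι ℝ) (hF : ∀ i j, Continuous fun x => F x i j)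
    (hH : ∀ x, (F x).IsHermitian) (T : Finset ℝ) {a b : ℝ} (hab : a ≤ b)
    (hT : ∀ x ∈ Set.Icc a b, (F x).det = 0 → x ∈ T) (ha : (F a).det ≠ 0) (hb : (F b).det ≠ 0) :
    Fintype.card {j // (hH b).eigenvalues j < 0}
        ≤ Fintype.card {j // (hH a).eigenvalues j < 0} + ∑ t ∈ T.filter (fun t => a < t ∧ t < b),
          (Fintype.card ι - (F t).rank) ∧
      Fintype.card {j // (hH a).eigenvalues j < 0}
        ≤ Fintype.card {j // (hH b).eigenvalues j < 0} + ∑ t ∈ T.filter (fun t => a < t ∧ t < b),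
          (Fintype.card ι - (F t).rank) := by
  -- the half-open sum equals the open sum since `corank F(a) = 0`
  have hsum : ∑ t ∈ T.filter (fun t => a ≤ t ∧ t < b), (Fintype.card ι - (F t).rank)
      = ∑ t ∈ T.filter (fun t => a < t ∧ t < b), (Fintype.card ι - (F t).rank) := by
    rw [← Finset.sum_filter_add_sum_filter_not (T.filter fun t => a ≤ t ∧ t < b) (fun t => t = a), Finset.filter_filter,
      Finset.filter_filter]
    have h0 : ∑ t ∈ T.filter (fun t => (a ≤ t ∧ t < b) ∧ t = a), (Fintype.card ι - (F t).rank) = 0 :=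
      Finset.sum_eq_zero fun t ht => by
        obtain ⟨-, -, rfl⟩ := Finset.mem_filter.1 ht
        exact corank_eq_zero_of_det_ne_zero ha
    rw [h0, zero_add]
    refine Finset.sum_congr (Finset.filter_congr fun t _ => ?_) fun _ _ => rfl
    constructor
    · rintro ⟨⟨h1, h2⟩, h3⟩; exact ⟨lt_of_le_of_ne h1 (Ne.symm h3), h2⟩
    · rintro ⟨h1, h2⟩; exact ⟨⟨h1.le, h2⟩, ne_of_gt h1⟩
  have h1 := negIndex_le_add_sum_corank F hF hH T hab hT
  have h2 := posIndex_le_add_sum_corank F hF hH T hab hT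
  rw [hsum] at h1 h2
  have ca := negIndex_add_posIndex_add_corank (hH a)
  have cb := negIndex_add_posIndex_add_corank (hH b)
  rw [corank_eq_zero_of_det_ne_zero ha] at ca
  rw [corank_eq_zero_of_det_ne_zero hb] at cb
  omega

/-! ## §3 Lacunary symmetric pencils: roots counted with multiplicity -/

section Pencil

variable {κ : Type} [Fintype κ]

omit [Fintype ι] [DecidableEq ι] in
/-- Entries of the evaluated pencil are continuous in the scale. [folklore] -/
theorem continuous_pencil_entry (d : κ → ℕ) (S : κ → Matrix ι ι ℝ) (i j : ι) :
    Continuous fun x : ℝ => (∑ k, x ^ d k • S k) i j := by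
  have h : (fun x : ℝ => (∑ k, x ^ d k • S k) i j) = fun x => ∑ k, x ^ d k * S k i j := by
    funext x; simp [Matrix.sum_apply, Matrix.smul_apply, smul_eq_mul]
  rw [h]
  exact continuous_finsetSum _ fun k _ => (continuous_pow (d k)).mul continuous_const

omit [Fintype ι] [DecidableEq ι] in
/-- The evaluated pencil of symmetric letters is hermitian. [folklore] -/
theorem isHermitian_pencil (d : κ → ℕ) (S : κ → Matrix ι ι ℝ) (hS : ∀ k, (S k).IsSymm) (x : ℝ) :
    (∑ k, x ^ d k • S k).IsHermitian := by
  refine isHermitian_of_isSymm ?_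
  unfold Matrix.IsSymm
  rw [Matrix.transpose_sum]
  exact Finset.sum_congr rfl fun k _ => by rw [Matrix.transpose_smul, (hS k).eq]

/-- The distinct real roots of `det F` contain every singular scale. [folklore] -/
theorem mem_rootSet_of_det_eq_zero (d : κ → ℕ) (S : κ → Matrix ι ι ℝ)
    (hdet : Matrix.det (∑ k, ((X : ℝ[X]) ^ d k) • (S k).map C) ≠ 0) {x : ℝ}
    (hx : (∑ k, x ^ d k • S k).det = 0) :
    x ∈ (Matrix.det (∑ k, ((X : ℝ[X]) ^ d k) • (S k).map C)).roots.toFinset := by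
  rw [Multiset.mem_toFinset, mem_roots hdet, IsRoot, DefiniteMoments.eval_det_pencil]
  exact hx

/-- **Coranks are paid for by multiplicities**: over any finite set of scales, `∑ corank F(t) ≤ ∑ mult_t det F`, and the
latter is at most the number of roots of `det F` counted with multiplicity among those scales. [folklore] -/
theorem sum_corank_le_card_roots_filter (d : κ → ℕ) (S : κ → Matrix ι ι ℝ)
    (hdet : Matrix.det (∑ k, ((X : ℝ[X]) ^ d k) • (S k).map C) ≠ 0) (p : ℝ → Prop) [DecidablePred p] :
    ∑ t ∈ (Matrix.det (∑ k, ((X : ℝ[X]) ^ d k) • (S k).map C)).roots.toFinset.filter p,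
        (Fintype.card ι - (∑ k, t ^ d k • S k).rank)
      ≤ Multiset.card ((Matrix.det (∑ k, ((X : ℝ[X]) ^ d k) • (S k).map C)).roots.filter p) := by
  set P := Matrix.det (∑ k, ((X : ℝ[X]) ^ d k) • (S k).map C) with hP
  calc ∑ t ∈ P.roots.toFinset.filter p, (Fintype.card ι - (∑ k, t ^ d k • S k).rank)
      ≤ ∑ t ∈ P.roots.toFinset.filter p, P.rootMultiplicity t :=
        Finset.sum_le_sum fun t _ => Multiplicity.le_rootMultiplicity_det_pencil_of_rank d S hdet t _ (by
          have := Matrix.rank_le_card_width (∑ k, t ^ d k • S k)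
          omega)
    _ = ∑ t ∈ (P.roots.filter p).toFinset, (P.roots.filter p).count t := by
        rw [Multiset.toFinset_filter]
        refine Finset.sum_congr rfl fun t ht => ?_
        rw [Multiset.count_filter_of_pos (Finset.mem_filter.1 ht).2, count_roots]
    _ = Multiset.card (P.roots.filter p) := Multiset.toFinset_sum_count_eq _

/-- **THE INERTIA LAW FOR ROOT COUNTS (lacunary symmetric pencils, every format).**  `F(X) = ∑ₖ X^{dₖ} Sₖ` with real
symmetric letters and `det F ≢ 0`, `a ≤ b`.  Then the negative index of `F(b)` exceeds that of `F(a)` by at most the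
number of roots of `det F` in `[a, b)` COUNTED WITH MULTIPLICITY. [folklore] -/
theorem pencil_negIndex_le_add_card_roots (d : κ → ℕ) (S : κ → Matrix ι ι ℝ) (hS : ∀ k, (S k).IsSymm)
    (hdet : Matrix.det (∑ k, ((X : ℝ[X]) ^ d k) • (S k).map C) ≠ 0) {a b : ℝ} (hab : a ≤ b) :
    Fintype.card {j // (isHermitian_pencil d S hS b).eigenvalues j < 0}
      ≤ Fintype.card {j // (isHermitian_pencil d S hS a).eigenvalues j < 0}
        + Multiset.card ((Matrix.det (∑ k, ((X : ℝ[X]) ^ d k) • (S k).map C)).roots.filter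
            (fun t => a ≤ t ∧ t < b)) := by
  classical
  have h := negIndex_le_add_sum_corank (fun x => ∑ k, x ^ d k • S k) (continuous_pencil_entry d S)
    (isHermitian_pencil d S hS) (Matrix.det (∑ k, ((X : ℝ[X]) ^ d k) • (S k).map C)).roots.toFinset hab
    (fun x _ hx => mem_rootSet_of_det_eq_zero d S hdet hx)
  exact le_trans h (Nat.add_le_add_left (sum_corank_le_card_roots_filter d S hdet _) _)

/-- **Positive-index form.** [folklore] -/
theorem pencil_posIndex_le_add_card_roots (d : κ → ℕ) (S : κ → Matrix ι ι ℝ) (hS : ∀ k, (S k).IsSymm)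
    (hdet : Matrix.det (∑ k, ((X : ℝ[X]) ^ d k) • (S k).map C) ≠ 0) {a b : ℝ} (hab : a ≤ b) :
    Fintype.card {j // 0 < (isHermitian_pencil d S hS b).eigenvalues j}
      ≤ Fintype.card {j // 0 < (isHermitian_pencil d S hS a).eigenvalues j}
        + Multiset.card ((Matrix.det (∑ k, ((X : ℝ[X]) ^ d k) • (S k).map C)).roots.filter
            (fun t => a ≤ t ∧ t < b)) := by
  classical
  have h := posIndex_le_add_sum_corank (fun x => ∑ k, x ^ d k • S k) (continuous_pencil_entry d S)
    (isHermitian_pencil d S hS) (Matrix.det (∑ k, ((X : ℝ[X]) ^ d k) • (S k).map C)).roots.toFinset hab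
    (fun x _ hx => mem_rootSet_of_det_eq_zero d S hdet hx)
  exact le_trans h (Nat.add_le_add_left (sum_corank_le_card_roots_filter d S hdet _) _)

end Pencil

end Inertia

end Summit.ValiantsHypothesis.ValiantsHypothesis.Theorems.LacunarySymmetroidMatrixDescartes
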